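import Summits.QuantumFields.YangMills.Theorems.UnitScaleGibbsFirstVariationFluxPairing
import Summits.QuantumFields.YangMills.Theorems.UnitScaleGibbsActionDerivativeSlotDerivativesRight
import HarnessLib

/-!
# `UnitScaleGibbsActionDerivFlatPairing` — THE SCHWINGER–DYSON OBSERVABLE `actionDeriv` OF `stub_linTest` IS THE FLAT FLUX PAIRING ON A SMALL BOX:
# `|∂_uA_W(V) + (1∕N)·Σ_p Re tr((u_{b₀}+u_{b₁}−u_{b₂}−u_{b₃})·(V(∂p) − 1))| ≤ 8·η·θ·Σ_p s_p(u)` (LEFT flow; LINE 28 «GrossTransfer», crux `UnitScaleTilt.HistoryTailL`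
# stmt-QuantumFields-19936 ∕ `MeanDeviationL` stmt-QuantumFields-23083)

Cell `ym3-torus` (YM ladder rung R3 = continuum SU(2) Yang–Mills on T³ — a RUNG, NOT the Clay problem: not d = 4, not infinite volume, not a mass gap),
width seat `ym-ust-19936-w2` (gen 15), pen of record of `stub_linTest`.  The stub's Schwinger–Dyson observable is px17's LEFT-flow derivative
✓`UnitScaleGibbsActionDerivativeSlotCalculus.actionDeriv ρ u V` (`U_b ↦ e^{tu_b}U_b`); px10 g7's ✓`UnitScaleGibbsFirstVariationFluxPairing.abs_deriv_sub_flatPairing_le_local`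
linearises the RIGHT chart `s ↦ A_W(expChart V (s•Y))` (`U_b ↦ U_b·e^{sY_b}`).  THIS FILE closes the gap: §1 the left insertions of `u` ARE the right insertions of the
transported letters `u′_b = ρ(V_b)⁻¹·u_b·ρ(V_b)` (`slotIns_eq_slotInsR_conj`), so `actionDeriv ρ u V = actionDerivR ρ u′ V` for EVERY gauge group and matrix model
(`actionDeriv_eq_actionDerivR_conj`); §2 for `SU(N)` and `u = ↑Y`, `u′ = ↑(specialUnitaryAd (V_b)⁻¹ (Y b))` and px17's ✓`actionDerivR_eq_deriv_expChart` give
`actionDeriv (fundamentalRep) ↑Y V = d∕ds A_W(expChart V (s•Y′))∣₀`; §3 px10's right-chart estimate at `Y′` plus `‖Y′_b − Y_b‖ ≤ 2‖V_b − 1‖·‖Y_b‖`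
(✓`norm_conj_sub_self_le_two_mul`) and `‖Y′_b‖ = ‖Y_b‖` (✓`opNorm_conj_unitary`) give ★★`abs_actionDeriv_sub_flatPairing_le_local` and the EVENT FORM
★★★`abs_actionDeriv_axialGaugeRep_sub_flatPairing_le` (`PlaqSmallOn (boxPlaqs lo hi) θ U`, `V = U^{axialGauge U lo hi}`, `η = (d−1)nθ`, constant `8`).
HONEST FRAMING.  Finite-dimensional matrix calculus over landed files; `--supports` helper; proves no stub, crux, rung or summit statement; `stub_linTest`,
«ShallowFluxSecondMomentL», (Q), K1, `MeanDeviationL`, `HistoryTailL` are NOT proved; the Yang–Mills mass gap is NOT proved.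
References: [GrossCMP1983] Thm 2.2 (proof) p.143; [Balaban1985BackgroundPropagators] (3.6)–(3.7) p.391; [Creutz2022] Ch. 11.
-/

set_option autoImplicit false

noncomputable section

open scoped BigOperators Matrix.Norms.L2Operator
open Literature.MathematicalPhysics.QuantumFieldTheory.Balaban1983to89
open Literature.MathematicalPhysics.QuantumFieldTheory.Balaban1983to89.T4AdjointCovarianceUnitary (lieSU specialUnitaryAd coe_specialUnitaryAd opNorm_conj_unitary toUnitary)
open Literature.MathematicalPhysics.QuantumFieldTheory.Balaban1983to89.T4AxialGaugeSmallField (boxPlaqs boxBonds axialGauge)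
open Literature.MathematicalPhysics.QuantumFieldTheory.Balaban1983to89.Node00 (expChart)
open Literature.MathematicalPhysics.QuantumLattice (fundamentalRep fundamentalRep_apply)
open Summit.QuantumFields.YangMills.Theorems.UnitScaleGibbsActionDerivativeSlotCalculus (slot slotIns slotBond word actionDeriv)
open Summit.QuantumFields.YangMills.Theorems.UnitScaleGibbsActionDerivativeSlotCalculusRight (slotInsR actionDerivR actionDerivR_eq_deriv_expChart)
open Summit.QuantumFields.YangMills.Theorems.UnitScaleGibbsFirstVariationFluxPairing
  (abs_deriv_sub_flatPairing_le_local norm_conj_sub_self_le_two_mul abs_re_trace_sub_re_trace_flat_le)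
open Summit.QuantumFields.YangMills.Theorems.UnitScaleGibbsOnEventHessianAxialGauge
  (norm_coe_sub_one_le_two norm_gaugeAct_axialGauge_sub_one_le support_hyp_of_vanish_off_inner mem_boxPlaqs_of_bond_mem_inner)

open Literature.MathematicalPhysics.QuantumFieldTheory.Balaban1983to89.T4AxialGaugeSmallField (castSite castSite_add_e)
open Literature.MathematicalPhysics.QuantumFieldTheory.Balaban1983to89.B7Prop1Explicit (e)
open Summit.QuantumFields.YangMills.Theorems.UnitScaleGibbsOnEventHessianAxialGauge (e_apply_nonneg)

namespace Summit.QuantumFields.YangMills.Theorems.UnitScaleGibbsActionDerivFlatPairing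

/-! ## §1 Left insertions are right insertions of the transported letters (any gauge group, any matrix model) -/

section AnyGroup

variable {N : ℕ} {P : Params} {j : ℕ} {G : Type} [GaugeGroup G]
  (ρ : G →* Matrix (Fin N) (Fin N) ℂ) (u : PBond P j → Matrix (Fin N) (Fin N) ℂ)

/-- ★ `slotIns ρ u V p = slotInsR ρ u′ V p` with `u′_b = ρ(V_b⁻¹)·u_b·ρ(V_b)`: `ρV·(ρV⁻¹ u ρV) = u·ρV` on direct slots, `(−ρV⁻¹uρV)·ρV⁻¹ = ρV⁻¹·(−u)` on inverse slots.
[cite: Creutz2022, Ch. 11] -/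
theorem slotIns_eq_slotInsR_conj (V : GaugeField P j G) (p : Plaq P j) :
    slotIns ρ u V p = slotInsR ρ (fun b => ρ (V b)⁻¹ * u b * ρ (V b)) V p := by
  have hVV : ∀ b : PBond P j, ρ (V b) * ρ (V b)⁻¹ = 1 := fun b => by rw [← map_mul, mul_inv_cancel, map_one]
  have hVV' : ∀ b : PBond P j, ρ (V b)⁻¹ * ρ (V b) = 1 := fun b => by rw [← map_mul, inv_mul_cancel, map_one]
  funext i
  fin_cases i
  · show u ⟨p.src, p.μ⟩ * ρ (V ⟨p.src, p.μ⟩) = ρ (V ⟨p.src, p.μ⟩) * (ρ (V ⟨p.src, p.μ⟩)⁻¹ * u ⟨p.src, p.μ⟩ * ρ (V ⟨p.src, p.μ⟩))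
    rw [← Matrix.mul_assoc, ← Matrix.mul_assoc, hVV, Matrix.one_mul]
  · show u ⟨p.src.shift p.μ, p.ν⟩ * ρ (V ⟨p.src.shift p.μ, p.ν⟩) =
      ρ (V ⟨p.src.shift p.μ, p.ν⟩) * (ρ (V ⟨p.src.shift p.μ, p.ν⟩)⁻¹ * u ⟨p.src.shift p.μ, p.ν⟩ * ρ (V ⟨p.src.shift p.μ, p.ν⟩))
    rw [← Matrix.mul_assoc, ← Matrix.mul_assoc, hVV, Matrix.one_mul]
  · show ρ (V ⟨p.src.shift p.ν, p.μ⟩)⁻¹ * (-u ⟨p.src.shift p.ν, p.μ⟩) =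
      -(ρ (V ⟨p.src.shift p.ν, p.μ⟩)⁻¹ * u ⟨p.src.shift p.ν, p.μ⟩ * ρ (V ⟨p.src.shift p.ν, p.μ⟩)) * ρ (V ⟨p.src.shift p.ν, p.μ⟩)⁻¹
    rw [Matrix.neg_mul, Matrix.mul_neg, Matrix.mul_assoc, hVV, Matrix.mul_one]
  · show ρ (V ⟨p.src, p.ν⟩)⁻¹ * (-u ⟨p.src, p.ν⟩) = -(ρ (V ⟨p.src, p.ν⟩)⁻¹ * u ⟨p.src, p.ν⟩ * ρ (V ⟨p.src, p.ν⟩)) * ρ (V ⟨p.src, p.ν⟩)⁻¹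
    rw [Matrix.neg_mul, Matrix.mul_neg, Matrix.mul_assoc, hVV, Matrix.mul_one]

/-- ★ `actionDeriv ρ u V = actionDerivR ρ u′ V`, `u′_b = ρ(V_b⁻¹)·u_b·ρ(V_b)`. [cite: GrossCMP1983, Thm 2.2 (proof)] -/
theorem actionDeriv_eq_actionDerivR_conj (V : GaugeField P j G) :
    actionDeriv ρ u V = actionDerivR ρ (fun b => ρ (V b)⁻¹ * u b * ρ (V b)) V := by
  unfold actionDeriv actionDerivR
  refine Finset.sum_congr rfl fun p _ => Finset.sum_congr rfl fun i _ => ?_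
  rw [slotIns_eq_slotInsR_conj ρ u V p]

end AnyGroup

/-! ## §2 `SU(N)`: the left observable as a right-chart derivative at the transported tangent -/

section SpecialUnitary

variable {N : ℕ} [NeZero N] {P : Params} {j : ℕ}

omit [NeZero N] in
/-- The transported tangent `Y′_b := Ad((V_b)⁻¹)(Y_b)`, on matrices: `↑Y′_b = ↑(V_b⁻¹)·↑Y_b·↑V_b`. [folklore] -/
theorem coe_transported (V : GaugeField P j (Matrix.specialUnitaryGroup (Fin N) ℂ)) (Y : PBond P j → lieSU (Fin N)) (b : PBond P j) :
    ((specialUnitaryAd (V b)⁻¹ (Y b) : lieSU (Fin N)) : Matrix (Fin N) (Fin N) ℂ) =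
      fundamentalRep (Fin N) (V b)⁻¹ * (Y b : Matrix (Fin N) (Fin N) ℂ) * fundamentalRep (Fin N) (V b) := by
  have hinv : (((V b)⁻¹ : Matrix.specialUnitaryGroup (Fin N) ℂ) : Matrix (Fin N) (Fin N) ℂ) = star ((V b : Matrix.specialUnitaryGroup (Fin N) ℂ) : Matrix (Fin N) (Fin N) ℂ) :=
    congrArg Subtype.val (Matrix.star_eq_inv (V b)).symm
  rw [coe_specialUnitaryAd, fundamentalRep_apply, fundamentalRep_apply, hinv, star_star]

/-- ★ `actionDeriv (fundamentalRep) ↑Y V = d∕ds A_W(expChart V (s • Y′))∣₀` with `Y′_b = Ad(V_b⁻¹) Y_b`. [cite: Balaban1985BackgroundPropagators, (3.6) p.391] -/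
theorem actionDeriv_eq_deriv_expChart_transported (V : GaugeField P j (Matrix.specialUnitaryGroup (Fin N) ℂ)) (Y : PBond P j → lieSU (Fin N)) :
    actionDeriv (fundamentalRep (Fin N)) (fun b => (Y b : Matrix (Fin N) (Fin N) ℂ)) V =
      deriv (fun s : ℝ => wilsonAction4 (expChart V (s • fun b => specialUnitaryAd (V b)⁻¹ (Y b)))) 0 := by
  rw [actionDeriv_eq_actionDerivR_conj, ← actionDerivR_eq_deriv_expChart]
  congr 1
  funext b
  rw [coe_transported]

end SpecialUnitary

/-! ## §3 The flat-pairing estimate for the left observable -/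

section Estimate

variable {N : ℕ} [NeZero N] {P : Params} {j : ℕ}

omit [NeZero N] in
/-- Letters: `‖↑Y′_b‖ = ‖↑Y_b‖` and `‖↑Y′_b − ↑Y_b‖ ≤ 2‖V_b − 1‖·‖↑Y_b‖`. [cite: Balaban1985Averaging, (19)–(20) p.21] -/
theorem norm_transported (V : GaugeField P j (Matrix.specialUnitaryGroup (Fin N) ℂ)) (Y : PBond P j → lieSU (Fin N)) (b : PBond P j) :
    ‖((specialUnitaryAd (V b)⁻¹ (Y b) : lieSU (Fin N)) : Matrix (Fin N) (Fin N) ℂ)‖ = ‖(Y b : Matrix (Fin N) (Fin N) ℂ)‖ ∧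
      ‖((specialUnitaryAd (V b)⁻¹ (Y b) : lieSU (Fin N)) : Matrix (Fin N) (Fin N) ℂ) - (Y b : Matrix (Fin N) (Fin N) ℂ)‖
        ≤ 2 * ‖((V b : Matrix.specialUnitaryGroup (Fin N) ℂ) : Matrix (Fin N) (Fin N) ℂ) - 1‖ * ‖(Y b : Matrix (Fin N) (Fin N) ℂ)‖ := by
  rw [coe_specialUnitaryAd]
  refine ⟨opNorm_conj_unitary (toUnitary (V b)⁻¹) _, ?_⟩
  have hmem : (((V b)⁻¹ : Matrix.specialUnitaryGroup (Fin N) ℂ) : Matrix (Fin N) (Fin N) ℂ) ∈ unitary (Matrix (Fin N) (Fin N) ℂ) := ((V b)⁻¹).2.1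
  refine (norm_conj_sub_self_le_two_mul hmem _).trans (le_of_eq ?_)
  congr 2
  -- `‖V⁻¹ − 1‖ = ‖V − 1‖`
  have hinv : (((V b)⁻¹ : Matrix.specialUnitaryGroup (Fin N) ℂ) : Matrix (Fin N) (Fin N) ℂ) = star ((V b : Matrix.specialUnitaryGroup (Fin N) ℂ) : Matrix (Fin N) (Fin N) ℂ) :=
    congrArg Subtype.val (Matrix.star_eq_inv (V b)).symm
  rw [hinv]
  exact Node00.norm_star_sub_one _

/-- ★★ **LOCAL FORM**: for every `SU(N)` field `V`, every `Y`, and budgets `δ_p` (the three transporting bonds AND the fourth bond of `p` within `δ_p` of `1`),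
`ε_p ≥ ‖V(∂p) − 1‖`: `|actionDeriv (fundamentalRep) ↑Y V + (1∕N)Σ_p Re tr((Y_{b₀}+Y_{b₁}−Y_{b₂}−Y_{b₃})·(V(∂p) − 1))| ≤ 14·Σ_p δ_p·ε_p·s_p(Y)`,
`s_p(Y) = Σ_{i<4}‖Y_{b_i}‖`. [cite: GrossCMP1983, Thm 2.2 (proof)] [cite: Balaban1985BackgroundPropagators, (3.7) p.391] -/
theorem abs_actionDeriv_sub_flatPairing_le_local (V : GaugeField P j (Matrix.specialUnitaryGroup (Fin N) ℂ)) (Y : PBond P j → lieSU (Fin N)) (δ ε : Plaq P j → ℝ)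
    (hδ : ∀ p : Plaq P j, ‖((V ⟨p.src, p.μ⟩ : Matrix.specialUnitaryGroup (Fin N) ℂ) : Matrix (Fin N) (Fin N) ℂ) - 1‖ ≤ δ p ∧
      ‖((V ⟨p.src.shift p.μ, p.ν⟩ : Matrix.specialUnitaryGroup (Fin N) ℂ) : Matrix (Fin N) (Fin N) ℂ) - 1‖ ≤ δ p ∧
      ‖((V ⟨p.src.shift p.ν, p.μ⟩ : Matrix.specialUnitaryGroup (Fin N) ℂ) : Matrix (Fin N) (Fin N) ℂ) - 1‖ ≤ δ p ∧
      ‖((V ⟨p.src, p.ν⟩ : Matrix.specialUnitaryGroup (Fin N) ℂ) : Matrix (Fin N) (Fin N) ℂ) - 1‖ ≤ δ p)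
    (hε : ∀ p : Plaq P j, ‖((GaugeField.plaqHol V p : Matrix.specialUnitaryGroup (Fin N) ℂ) : Matrix (Fin N) (Fin N) ℂ) - 1‖ ≤ ε p) :
    |actionDeriv (fundamentalRep (Fin N)) (fun b => (Y b : Matrix (Fin N) (Fin N) ℂ)) V
        - -(∑ p : Plaq P j, (Matrix.trace (((Y ⟨p.src, p.μ⟩ : Matrix (Fin N) (Fin N) ℂ) + (Y ⟨p.src.shift p.μ, p.ν⟩ : Matrix (Fin N) (Fin N) ℂ)
            - (Y ⟨p.src.shift p.ν, p.μ⟩ : Matrix (Fin N) (Fin N) ℂ) - (Y ⟨p.src, p.ν⟩ : Matrix (Fin N) (Fin N) ℂ))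
            * (((GaugeField.plaqHol V p : Matrix.specialUnitaryGroup (Fin N) ℂ) : Matrix (Fin N) (Fin N) ℂ) - 1))).re) / (Fintype.card (Fin N) : ℝ)|
      ≤ 14 * ∑ p : Plaq P j, δ p * ε p * (‖(Y ⟨p.src, p.μ⟩ : Matrix (Fin N) (Fin N) ℂ)‖ + ‖(Y ⟨p.src.shift p.μ, p.ν⟩ : Matrix (Fin N) (Fin N) ℂ)‖
        + ‖(Y ⟨p.src.shift p.ν, p.μ⟩ : Matrix (Fin N) (Fin N) ℂ)‖ + ‖(Y ⟨p.src, p.ν⟩ : Matrix (Fin N) (Fin N) ℂ)‖) := by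
  set Y' : PBond P j → lieSU (Fin N) := fun b => specialUnitaryAd (V b)⁻¹ (Y b) with hY'
  have hN : (0 : ℝ) < (Fintype.card (Fin N) : ℝ) := Nat.cast_pos.mpr (Fintype.card_pos (α := Fin N))
  rw [actionDeriv_eq_deriv_expChart_transported]
  -- px10's right-chart estimate at the transported tangent
  have h1 := abs_deriv_sub_flatPairing_le_local V Y' δ ε (fun p => ⟨(hδ p).1, (hδ p).2.1, (hδ p).2.2.1⟩) hε
  -- the transported letters have the same norms
  have hnorm : ∀ b, ‖(Y' b : Matrix (Fin N) (Fin N) ℂ)‖ = ‖(Y b : Matrix (Fin N) (Fin N) ℂ)‖ := fun b => (norm_transported V Y b).1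
  have hdiff : ∀ b, ‖(Y' b : Matrix (Fin N) (Fin N) ℂ) - (Y b : Matrix (Fin N) (Fin N) ℂ)‖
      ≤ 2 * ‖((V b : Matrix.specialUnitaryGroup (Fin N) ℂ) : Matrix (Fin N) (Fin N) ℂ) - 1‖ * ‖(Y b : Matrix (Fin N) (Fin N) ℂ)‖ :=
    fun b => (norm_transported V Y b).2
  simp only [hnorm] at h1
  -- the two flat pairings differ by `≤ 8 Σ_p δ_p ε_p s_p(Y)`
  have h2 : |-(∑ p : Plaq P j, (Matrix.trace (((Y' ⟨p.src, p.μ⟩ : Matrix (Fin N) (Fin N) ℂ) + (Y' ⟨p.src.shift p.μ, p.ν⟩ : Matrix (Fin N) (Fin N) ℂ)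
            - (Y' ⟨p.src.shift p.ν, p.μ⟩ : Matrix (Fin N) (Fin N) ℂ) - (Y' ⟨p.src, p.ν⟩ : Matrix (Fin N) (Fin N) ℂ))
            * (((GaugeField.plaqHol V p : Matrix.specialUnitaryGroup (Fin N) ℂ) : Matrix (Fin N) (Fin N) ℂ) - 1))).re) / (Fintype.card (Fin N) : ℝ)
        - -(∑ p : Plaq P j, (Matrix.trace (((Y ⟨p.src, p.μ⟩ : Matrix (Fin N) (Fin N) ℂ) + (Y ⟨p.src.shift p.μ, p.ν⟩ : Matrix (Fin N) (Fin N) ℂ)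
            - (Y ⟨p.src.shift p.ν, p.μ⟩ : Matrix (Fin N) (Fin N) ℂ) - (Y ⟨p.src, p.ν⟩ : Matrix (Fin N) (Fin N) ℂ))
            * (((GaugeField.plaqHol V p : Matrix.specialUnitaryGroup (Fin N) ℂ) : Matrix (Fin N) (Fin N) ℂ) - 1))).re) / (Fintype.card (Fin N) : ℝ)|
      ≤ 8 * ∑ p : Plaq P j, δ p * ε p * (‖(Y ⟨p.src, p.μ⟩ : Matrix (Fin N) (Fin N) ℂ)‖ + ‖(Y ⟨p.src.shift p.μ, p.ν⟩ : Matrix (Fin N) (Fin N) ℂ)‖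
        + ‖(Y ⟨p.src.shift p.ν, p.μ⟩ : Matrix (Fin N) (Fin N) ℂ)‖ + ‖(Y ⟨p.src, p.ν⟩ : Matrix (Fin N) (Fin N) ℂ)‖) := by
    rw [show ∀ (a b : Plaq P j → ℝ) (N' : ℝ), -(∑ p, a p) / N' - -(∑ p, b p) / N' = -((∑ p, (a p - b p)) / N') by
      intro a b N'; rw [Finset.sum_sub_distrib]; ring]
    rw [abs_neg, abs_div, Nat.abs_cast, div_le_iff₀ hN, Finset.mul_sum, Finset.sum_mul]
    refine (Finset.abs_sum_le_sum_abs _ _).trans (Finset.sum_le_sum fun p _ => ?_)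
    set W : Matrix (Fin N) (Fin N) ℂ := ((GaugeField.plaqHol V p : Matrix.specialUnitaryGroup (Fin N) ℂ) : Matrix (Fin N) (Fin N) ℂ) - 1 with hW
    set D : Matrix (Fin N) (Fin N) ℂ := ((Y' ⟨p.src, p.μ⟩ : Matrix (Fin N) (Fin N) ℂ) + (Y' ⟨p.src.shift p.μ, p.ν⟩ : Matrix (Fin N) (Fin N) ℂ)
            - (Y' ⟨p.src.shift p.ν, p.μ⟩ : Matrix (Fin N) (Fin N) ℂ) - (Y' ⟨p.src, p.ν⟩ : Matrix (Fin N) (Fin N) ℂ)) -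
        ((Y ⟨p.src, p.μ⟩ : Matrix (Fin N) (Fin N) ℂ) + (Y ⟨p.src.shift p.μ, p.ν⟩ : Matrix (Fin N) (Fin N) ℂ)
            - (Y ⟨p.src.shift p.ν, p.μ⟩ : Matrix (Fin N) (Fin N) ℂ) - (Y ⟨p.src, p.ν⟩ : Matrix (Fin N) (Fin N) ℂ)) with hD
    have hsplit : (Matrix.trace (((Y' ⟨p.src, p.μ⟩ : Matrix (Fin N) (Fin N) ℂ) + (Y' ⟨p.src.shift p.μ, p.ν⟩ : Matrix (Fin N) (Fin N) ℂ)
            - (Y' ⟨p.src.shift p.ν, p.μ⟩ : Matrix (Fin N) (Fin N) ℂ) - (Y' ⟨p.src, p.ν⟩ : Matrix (Fin N) (Fin N) ℂ)) * W)).re -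
        (Matrix.trace (((Y ⟨p.src, p.μ⟩ : Matrix (Fin N) (Fin N) ℂ) + (Y ⟨p.src.shift p.μ, p.ν⟩ : Matrix (Fin N) (Fin N) ℂ)
            - (Y ⟨p.src.shift p.ν, p.μ⟩ : Matrix (Fin N) (Fin N) ℂ) - (Y ⟨p.src, p.ν⟩ : Matrix (Fin N) (Fin N) ℂ)) * W)).re = (Matrix.trace (D * W)).re := by
      simp only [hD, Matrix.sub_mul, Matrix.add_mul, Matrix.trace_sub, Matrix.trace_add, Complex.sub_re, Complex.add_re]
    rw [hsplit]
    -- `|Re tr(D W)| ≤ N ‖D‖ ‖W‖`, `‖D‖ ≤ Σ_i ‖Y'_{b_i} − Y_{b_i}‖ ≤ 2 δ_p s_p(Y)`, `‖W‖ ≤ ε_p`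
    have htr : |(Matrix.trace (D * W)).re| ≤ (Fintype.card (Fin N) : ℝ) * (‖D‖ * ‖W‖) := by
      have h := abs_re_trace_sub_re_trace_flat_le (σ := 0) (by simp) (-D) (W + 1)
      simp only [Matrix.zero_mul, Matrix.trace_zero, Complex.zero_re, zero_sub, add_sub_cancel_right, abs_neg, norm_neg,
        Matrix.neg_mul, Matrix.trace_neg, Complex.neg_re] at h
      simpa using h
    obtain ⟨d0, d1, d2, d3⟩ := hδ p
    have hδ0 : 0 ≤ δ p := (norm_nonneg _).trans d0
    have hDle : ‖D‖ ≤ 2 * δ p * (‖(Y ⟨p.src, p.μ⟩ : Matrix (Fin N) (Fin N) ℂ)‖ + ‖(Y ⟨p.src.shift p.μ, p.ν⟩ : Matrix (Fin N) (Fin N) ℂ)‖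
        + ‖(Y ⟨p.src.shift p.ν, p.μ⟩ : Matrix (Fin N) (Fin N) ℂ)‖ + ‖(Y ⟨p.src, p.ν⟩ : Matrix (Fin N) (Fin N) ℂ)‖) := by
      have e : D = ((Y' ⟨p.src, p.μ⟩ : Matrix (Fin N) (Fin N) ℂ) - Y ⟨p.src, p.μ⟩) + ((Y' ⟨p.src.shift p.μ, p.ν⟩ : Matrix (Fin N) (Fin N) ℂ) - Y ⟨p.src.shift p.μ, p.ν⟩)
          - ((Y' ⟨p.src.shift p.ν, p.μ⟩ : Matrix (Fin N) (Fin N) ℂ) - Y ⟨p.src.shift p.ν, p.μ⟩) - ((Y' ⟨p.src, p.ν⟩ : Matrix (Fin N) (Fin N) ℂ) - Y ⟨p.src, p.ν⟩) := by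
        rw [hD]; abel
      rw [e]
      have t0 := (hdiff ⟨p.src, p.μ⟩).trans (mul_le_mul_of_nonneg_right (mul_le_mul_of_nonneg_left d0 (by norm_num)) (norm_nonneg _))
      have t1 := (hdiff ⟨p.src.shift p.μ, p.ν⟩).trans (mul_le_mul_of_nonneg_right (mul_le_mul_of_nonneg_left d1 (by norm_num)) (norm_nonneg _))
      have t2 := (hdiff ⟨p.src.shift p.ν, p.μ⟩).trans (mul_le_mul_of_nonneg_right (mul_le_mul_of_nonneg_left d2 (by norm_num)) (norm_nonneg _))
      have t3 := (hdiff ⟨p.src, p.ν⟩).trans (mul_le_mul_of_nonneg_right (mul_le_mul_of_nonneg_left d3 (by norm_num)) (norm_nonneg _))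
      calc _ ≤ ‖((Y' ⟨p.src, p.μ⟩ : Matrix (Fin N) (Fin N) ℂ) - Y ⟨p.src, p.μ⟩) + ((Y' ⟨p.src.shift p.μ, p.ν⟩ : Matrix (Fin N) (Fin N) ℂ) - Y ⟨p.src.shift p.μ, p.ν⟩)
          - ((Y' ⟨p.src.shift p.ν, p.μ⟩ : Matrix (Fin N) (Fin N) ℂ) - Y ⟨p.src.shift p.ν, p.μ⟩)‖ + ‖(Y' ⟨p.src, p.ν⟩ : Matrix (Fin N) (Fin N) ℂ) - Y ⟨p.src, p.ν⟩‖ :=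
            norm_sub_le _ _
        _ ≤ ‖((Y' ⟨p.src, p.μ⟩ : Matrix (Fin N) (Fin N) ℂ) - Y ⟨p.src, p.μ⟩) + ((Y' ⟨p.src.shift p.μ, p.ν⟩ : Matrix (Fin N) (Fin N) ℂ) - Y ⟨p.src.shift p.μ, p.ν⟩)‖
          + ‖(Y' ⟨p.src.shift p.ν, p.μ⟩ : Matrix (Fin N) (Fin N) ℂ) - Y ⟨p.src.shift p.ν, p.μ⟩‖ + ‖(Y' ⟨p.src, p.ν⟩ : Matrix (Fin N) (Fin N) ℂ) - Y ⟨p.src, p.ν⟩‖ := by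
            gcongr; exact norm_sub_le _ _
        _ ≤ ‖(Y' ⟨p.src, p.μ⟩ : Matrix (Fin N) (Fin N) ℂ) - Y ⟨p.src, p.μ⟩‖ + ‖(Y' ⟨p.src.shift p.μ, p.ν⟩ : Matrix (Fin N) (Fin N) ℂ) - Y ⟨p.src.shift p.μ, p.ν⟩‖
          + ‖(Y' ⟨p.src.shift p.ν, p.μ⟩ : Matrix (Fin N) (Fin N) ℂ) - Y ⟨p.src.shift p.ν, p.μ⟩‖ + ‖(Y' ⟨p.src, p.ν⟩ : Matrix (Fin N) (Fin N) ℂ) - Y ⟨p.src, p.ν⟩‖ := by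
            gcongr; exact norm_add_le _ _
        _ ≤ 2 * δ p * ‖(Y ⟨p.src, p.μ⟩ : Matrix (Fin N) (Fin N) ℂ)‖ + 2 * δ p * ‖(Y ⟨p.src.shift p.μ, p.ν⟩ : Matrix (Fin N) (Fin N) ℂ)‖
          + 2 * δ p * ‖(Y ⟨p.src.shift p.ν, p.μ⟩ : Matrix (Fin N) (Fin N) ℂ)‖ + 2 * δ p * ‖(Y ⟨p.src, p.ν⟩ : Matrix (Fin N) (Fin N) ℂ)‖ :=
            add_le_add (add_le_add (add_le_add t0 t1) t2) t3
        _ = _ := by ring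
    have hWle : ‖W‖ ≤ ε p := hε p
    have hε0 : 0 ≤ ε p := (norm_nonneg _).trans (hε p)
    have hs0 : 0 ≤ ‖(Y ⟨p.src, p.μ⟩ : Matrix (Fin N) (Fin N) ℂ)‖ + ‖(Y ⟨p.src.shift p.μ, p.ν⟩ : Matrix (Fin N) (Fin N) ℂ)‖
        + ‖(Y ⟨p.src.shift p.ν, p.μ⟩ : Matrix (Fin N) (Fin N) ℂ)‖ + ‖(Y ⟨p.src, p.ν⟩ : Matrix (Fin N) (Fin N) ℂ)‖ := by positivity
    have hprod := mul_le_mul hDle hWle (norm_nonneg _) (by positivity)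
    calc |(Matrix.trace (D * W)).re| ≤ (Fintype.card (Fin N) : ℝ) * (‖D‖ * ‖W‖) := htr
      _ ≤ (Fintype.card (Fin N) : ℝ) * (2 * δ p * (‖(Y ⟨p.src, p.μ⟩ : Matrix (Fin N) (Fin N) ℂ)‖ + ‖(Y ⟨p.src.shift p.μ, p.ν⟩ : Matrix (Fin N) (Fin N) ℂ)‖
          + ‖(Y ⟨p.src.shift p.ν, p.μ⟩ : Matrix (Fin N) (Fin N) ℂ)‖ + ‖(Y ⟨p.src, p.ν⟩ : Matrix (Fin N) (Fin N) ℂ)‖) * ε p) :=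
          mul_le_mul_of_nonneg_left hprod hN.le
      _ ≤ 8 * (δ p * ε p * (‖(Y ⟨p.src, p.μ⟩ : Matrix (Fin N) (Fin N) ℂ)‖ + ‖(Y ⟨p.src.shift p.μ, p.ν⟩ : Matrix (Fin N) (Fin N) ℂ)‖
          + ‖(Y ⟨p.src.shift p.ν, p.μ⟩ : Matrix (Fin N) (Fin N) ℂ)‖ + ‖(Y ⟨p.src, p.ν⟩ : Matrix (Fin N) (Fin N) ℂ)‖)) * (Fintype.card (Fin N) : ℝ) := by
          have h4 : 0 ≤ (Fintype.card (Fin N) : ℝ) * (δ p * ε p * (‖(Y ⟨p.src, p.μ⟩ : Matrix (Fin N) (Fin N) ℂ)‖ + ‖(Y ⟨p.src.shift p.μ, p.ν⟩ : Matrix (Fin N) (Fin N) ℂ)‖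
              + ‖(Y ⟨p.src.shift p.ν, p.μ⟩ : Matrix (Fin N) (Fin N) ℂ)‖ + ‖(Y ⟨p.src, p.ν⟩ : Matrix (Fin N) (Fin N) ℂ)‖)) :=
            mul_nonneg hN.le (mul_nonneg (mul_nonneg hδ0 hε0) hs0)
          linarith [h4]
  -- combine
  have key := abs_sub_le (deriv (fun s : ℝ => wilsonAction4 (expChart V (s • Y'))) 0)
    (-(∑ p : Plaq P j, (Matrix.trace (((Y' ⟨p.src, p.μ⟩ : Matrix (Fin N) (Fin N) ℂ) + (Y' ⟨p.src.shift p.μ, p.ν⟩ : Matrix (Fin N) (Fin N) ℂ)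
            - (Y' ⟨p.src.shift p.ν, p.μ⟩ : Matrix (Fin N) (Fin N) ℂ) - (Y' ⟨p.src, p.ν⟩ : Matrix (Fin N) (Fin N) ℂ))
            * (((GaugeField.plaqHol V p : Matrix.specialUnitaryGroup (Fin N) ℂ) : Matrix (Fin N) (Fin N) ℂ) - 1))).re) / (Fintype.card (Fin N) : ℝ))
    (-(∑ p : Plaq P j, (Matrix.trace (((Y ⟨p.src, p.μ⟩ : Matrix (Fin N) (Fin N) ℂ) + (Y ⟨p.src.shift p.μ, p.ν⟩ : Matrix (Fin N) (Fin N) ℂ)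
            - (Y ⟨p.src.shift p.ν, p.μ⟩ : Matrix (Fin N) (Fin N) ℂ) - (Y ⟨p.src, p.ν⟩ : Matrix (Fin N) (Fin N) ℂ))
            * (((GaugeField.plaqHol V p : Matrix.specialUnitaryGroup (Fin N) ℂ) : Matrix (Fin N) (Fin N) ℂ) - 1))).re) / (Fintype.card (Fin N) : ℝ))
  have : (fun s : ℝ => wilsonAction4 (expChart V (s • fun b => specialUnitaryAd (V b)⁻¹ (Y b)))) = fun s : ℝ => wilsonAction4 (expChart V (s • Y')) := rfl
  rw [this]
  linarith [key, h1, h2]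

/-- ★★ **BONDWISE BOX FORM**: bond variables of `V` within `η` of `1` on `boxBonds lo hi`, plaquette variables within `θ` of `1` on `boxPlaqs lo hi`, `Y` vanishing off
the inner box `boxBonds (lo+1) (hi−1)` ⇒ `|actionDeriv (fundamentalRep) ↑Y V + (1∕N)Σ_p Re tr((dY)_p·(V(∂p) − 1))| ≤ 14·η·θ·Σ_p s_p(Y)`.
[cite: Balaban1985BackgroundPropagators, (3.7) p.391] [cite: GrossCMP1983, Thm 2.2] -/
theorem abs_actionDeriv_sub_flatPairing_le_of_bondSmallOn_box (V : GaugeField P j (Matrix.specialUnitaryGroup (Fin N) ℂ)) {lo hi : Fin P.d → ℤ} {η θ : ℝ}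
    (hV : ∀ b : PBond P j, b ∈ boxBonds lo hi → ‖((V b : Matrix.specialUnitaryGroup (Fin N) ℂ) : Matrix (Fin N) (Fin N) ℂ) - 1‖ ≤ η)
    (hVp : ∀ p : Plaq P j, p ∈ boxPlaqs lo hi → ‖((GaugeField.plaqHol V p : Matrix.specialUnitaryGroup (Fin N) ℂ) : Matrix (Fin N) (Fin N) ℂ) - 1‖ ≤ θ)
    (Y : PBond P j → lieSU (Fin N)) (hYsupp : ∀ b : PBond P j, b ∉ boxBonds (lo + 1) (hi - 1) → Y b = 0) :
    |actionDeriv (fundamentalRep (Fin N)) (fun b => (Y b : Matrix (Fin N) (Fin N) ℂ)) V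
        - -(∑ p : Plaq P j, (Matrix.trace (((Y ⟨p.src, p.μ⟩ : Matrix (Fin N) (Fin N) ℂ) + (Y ⟨p.src.shift p.μ, p.ν⟩ : Matrix (Fin N) (Fin N) ℂ)
            - (Y ⟨p.src.shift p.ν, p.μ⟩ : Matrix (Fin N) (Fin N) ℂ) - (Y ⟨p.src, p.ν⟩ : Matrix (Fin N) (Fin N) ℂ))
            * (((GaugeField.plaqHol V p : Matrix.specialUnitaryGroup (Fin N) ℂ) : Matrix (Fin N) (Fin N) ℂ) - 1))).re) / (Fintype.card (Fin N) : ℝ)|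
      ≤ 14 * η * θ * ∑ p : Plaq P j, (‖(Y ⟨p.src, p.μ⟩ : Matrix (Fin N) (Fin N) ℂ)‖ + ‖(Y ⟨p.src.shift p.μ, p.ν⟩ : Matrix (Fin N) (Fin N) ℂ)‖
        + ‖(Y ⟨p.src.shift p.ν, p.μ⟩ : Matrix (Fin N) (Fin N) ℂ)‖ + ‖(Y ⟨p.src, p.ν⟩ : Matrix (Fin N) (Fin N) ℂ)‖) := by
  classical
  -- the four bonds of a box plaquette are box bonds
  have hbonds : ∀ p : Plaq P j, p ∈ boxPlaqs lo hi → (⟨p.src, p.μ⟩ : PBond P j) ∈ boxBonds lo hi ∧ (⟨p.src.shift p.μ, p.ν⟩ : PBond P j) ∈ boxBonds lo hi ∧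
      (⟨p.src.shift p.ν, p.μ⟩ : PBond P j) ∈ boxBonds lo hi ∧ (⟨p.src, p.ν⟩ : PBond P j) ∈ boxBonds lo hi := by
    rintro p ⟨z, hlo, hhi, hsrc⟩
    have hμ0 := e_apply_nonneg (P := P) p.μ
    have hν0 := e_apply_nonneg (P := P) p.ν
    rw [Pi.le_def] at hlo hhi
    refine ⟨⟨z, Pi.le_def.2 hlo, Pi.le_def.2 fun κ => ?_, hsrc⟩, ⟨z + e p.μ, Pi.le_def.2 fun κ => ?_, Pi.le_def.2 fun κ => ?_, ?_⟩,
      ⟨z + e p.ν, Pi.le_def.2 fun κ => ?_, Pi.le_def.2 fun κ => ?_, ?_⟩, ⟨z, Pi.le_def.2 hlo, Pi.le_def.2 fun κ => ?_, hsrc⟩⟩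
    · have := hhi κ; simp only [Pi.add_apply] at this ⊢; linarith [hν0 κ]
    · have := hlo κ; simp only [Pi.add_apply]; linarith [hμ0 κ]
    · have := hhi κ; simp only [Pi.add_apply] at this ⊢; linarith
    · rw [hsrc, castSite_add_e]
    · have := hlo κ; simp only [Pi.add_apply]; linarith [hν0 κ]
    · have := hhi κ; simp only [Pi.add_apply] at this ⊢; linarith
    · rw [hsrc, castSite_add_e]
    · have := hhi κ; simp only [Pi.add_apply] at this ⊢; linarith [hμ0 κ]
  -- off the box the direction vanishes on `∂p`
  have hzero : ∀ p : Plaq P j, p ∉ boxPlaqs lo hi →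
      Y ⟨p.src, p.μ⟩ = 0 ∧ Y ⟨p.src.shift p.μ, p.ν⟩ = 0 ∧ Y ⟨p.src.shift p.ν, p.μ⟩ = 0 ∧ Y ⟨p.src, p.ν⟩ = 0 := by
    intro p hp
    have key : ∀ b : PBond P j, (b ∈ boxBonds (lo + 1) (hi - 1) → p ∈ boxPlaqs lo hi) → Y b = 0 := fun b hb => by
      by_cases hmem : b ∈ boxBonds (lo + 1) (hi - 1)
      · exact absurd (hb hmem) hp
      · exact hYsupp b hmem
    exact ⟨key _ fun h => mem_boxPlaqs_of_bond_mem_inner (Or.inl h), key _ fun h => mem_boxPlaqs_of_bond_mem_inner (Or.inr (Or.inl h)),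
      key _ fun h => mem_boxPlaqs_of_bond_mem_inner (Or.inr (Or.inr (Or.inl h))), key _ fun h => mem_boxPlaqs_of_bond_mem_inner (Or.inr (Or.inr (Or.inr h)))⟩
  set δ : Plaq P j → ℝ := fun p => if p ∈ boxPlaqs lo hi then η else 2 with hδ
  set ε : Plaq P j → ℝ := fun p => if p ∈ boxPlaqs lo hi then θ else 2 with hε
  have hδb : ∀ p : Plaq P j, ‖((V ⟨p.src, p.μ⟩ : Matrix.specialUnitaryGroup (Fin N) ℂ) : Matrix (Fin N) (Fin N) ℂ) - 1‖ ≤ δ p ∧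
      ‖((V ⟨p.src.shift p.μ, p.ν⟩ : Matrix.specialUnitaryGroup (Fin N) ℂ) : Matrix (Fin N) (Fin N) ℂ) - 1‖ ≤ δ p ∧
      ‖((V ⟨p.src.shift p.ν, p.μ⟩ : Matrix.specialUnitaryGroup (Fin N) ℂ) : Matrix (Fin N) (Fin N) ℂ) - 1‖ ≤ δ p ∧
      ‖((V ⟨p.src, p.ν⟩ : Matrix.specialUnitaryGroup (Fin N) ℂ) : Matrix (Fin N) (Fin N) ℂ) - 1‖ ≤ δ p := by
    intro p
    by_cases hp : p ∈ boxPlaqs lo hi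
    · have hδp : δ p = η := by rw [hδ]; simp only [hp, ↓reduceIte]
      obtain ⟨hb1, hb2, hb3, hb4⟩ := hbonds p hp
      rw [hδp]; exact ⟨hV _ hb1, hV _ hb2, hV _ hb3, hV _ hb4⟩
    · have hδp : δ p = 2 := by rw [hδ]; simp only [hp, ↓reduceIte]
      rw [hδp]; exact ⟨norm_coe_sub_one_le_two _, norm_coe_sub_one_le_two _, norm_coe_sub_one_le_two _, norm_coe_sub_one_le_two _⟩
  have hεb : ∀ p : Plaq P j, ‖((GaugeField.plaqHol V p : Matrix.specialUnitaryGroup (Fin N) ℂ) : Matrix (Fin N) (Fin N) ℂ) - 1‖ ≤ ε p := by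
    intro p
    by_cases hp : p ∈ boxPlaqs lo hi
    · have hεp : ε p = θ := by rw [hε]; simp only [hp, ↓reduceIte]
      rw [hεp]; exact hVp p hp
    · have hεp : ε p = 2 := by rw [hε]; simp only [hp, ↓reduceIte]
      rw [hεp]; exact norm_coe_sub_one_le_two _
  refine (abs_actionDeriv_sub_flatPairing_le_local V Y δ ε hδb hεb).trans ?_
  have hsum : ∑ p : Plaq P j, δ p * ε p * (‖(Y ⟨p.src, p.μ⟩ : Matrix (Fin N) (Fin N) ℂ)‖ + ‖(Y ⟨p.src.shift p.μ, p.ν⟩ : Matrix (Fin N) (Fin N) ℂ)‖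
        + ‖(Y ⟨p.src.shift p.ν, p.μ⟩ : Matrix (Fin N) (Fin N) ℂ)‖ + ‖(Y ⟨p.src, p.ν⟩ : Matrix (Fin N) (Fin N) ℂ)‖)
      ≤ ∑ p : Plaq P j, η * θ * (‖(Y ⟨p.src, p.μ⟩ : Matrix (Fin N) (Fin N) ℂ)‖ + ‖(Y ⟨p.src.shift p.μ, p.ν⟩ : Matrix (Fin N) (Fin N) ℂ)‖
        + ‖(Y ⟨p.src.shift p.ν, p.μ⟩ : Matrix (Fin N) (Fin N) ℂ)‖ + ‖(Y ⟨p.src, p.ν⟩ : Matrix (Fin N) (Fin N) ℂ)‖) := by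
    refine Finset.sum_le_sum fun p _ => ?_
    by_cases hp : p ∈ boxPlaqs lo hi
    · have hδp : δ p = η := by rw [hδ]; simp only [hp, ↓reduceIte]
      have hεp : ε p = θ := by rw [hε]; simp only [hp, ↓reduceIte]
      rw [hδp, hεp]
    · obtain ⟨z1, z2, z3, z4⟩ := hzero p hp
      rw [z1, z2, z3, z4]
      simp
  rw [← Finset.mul_sum] at hsum
  linarith [hsum]

/-- ★★★ **EVENT FORM — THE `stub_linTest` OBSERVABLE ON A θ-SMALL BOX**: `PlaqSmallOn (boxPlaqs lo hi) θ U` (side `≤ n < sitesPerDir j`),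
`V := U^{axialGauge U lo hi}`, `Y` vanishing off the inner box `boxBonds (lo+1) (hi−1)` ⇒
`|actionDeriv (fundamentalRep) ↑Y V + (1∕N)Σ_p Re tr((dY)_p·(V(∂p) − 1))| ≤ 14·(d−1)·n·θ·θ·Σ_p s_p(Y)`. [cite: Balaban1985BackgroundPropagators, (3.7) p.391] [cite: GrossCMP1983, Thm 2.2] -/
theorem abs_actionDeriv_axialGaugeRep_sub_flatPairing_le (U : GaugeField P j (Matrix.specialUnitaryGroup (Fin N) ℂ)) {lo hi : Fin P.d → ℤ} {θ : ℝ} {n : ℕ}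
    (hU : PlaqSmallOn (boxPlaqs lo hi) θ U) (hθ : 0 ≤ θ) (hn : ∀ κ, hi κ ≤ lo κ + n) (hnN : n < P.sitesPerDir j)
    (Y : PBond P j → lieSU (Fin N)) (hYsupp : ∀ b : PBond P j, b ∉ boxBonds (lo + 1) (hi - 1) → Y b = 0) :
    |actionDeriv (fundamentalRep (Fin N)) (fun b => (Y b : Matrix (Fin N) (Fin N) ℂ)) (GaugeField.gaugeAct (axialGauge U lo hi) U)
        - -(∑ p : Plaq P j, (Matrix.trace (((Y ⟨p.src, p.μ⟩ : Matrix (Fin N) (Fin N) ℂ) + (Y ⟨p.src.shift p.μ, p.ν⟩ : Matrix (Fin N) (Fin N) ℂ)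
            - (Y ⟨p.src.shift p.ν, p.μ⟩ : Matrix (Fin N) (Fin N) ℂ) - (Y ⟨p.src, p.ν⟩ : Matrix (Fin N) (Fin N) ℂ))
            * (((GaugeField.plaqHol (GaugeField.gaugeAct (axialGauge U lo hi) U) p : Matrix.specialUnitaryGroup (Fin N) ℂ) : Matrix (Fin N) (Fin N) ℂ) - 1))).re)
          / (Fintype.card (Fin N) : ℝ)|
      ≤ 14 * ((((P.d - 1 : ℕ) : ℝ) * n * θ)) * θ * ∑ p : Plaq P j, (‖(Y ⟨p.src, p.μ⟩ : Matrix (Fin N) (Fin N) ℂ)‖ + ‖(Y ⟨p.src.shift p.μ, p.ν⟩ : Matrix (Fin N) (Fin N) ℂ)‖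
        + ‖(Y ⟨p.src.shift p.ν, p.μ⟩ : Matrix (Fin N) (Fin N) ℂ)‖ + ‖(Y ⟨p.src, p.ν⟩ : Matrix (Fin N) (Fin N) ℂ)‖) := by
  refine abs_actionDeriv_sub_flatPairing_le_of_bondSmallOn_box _ (fun b hb => norm_gaugeAct_axialGauge_sub_one_le U hU hθ hn hnN hb)
    (fun p hp => ?_) Y hYsupp
  rw [← FederbushMean.dist1_SU_eq, T4ReTrLipUnitary.plaqHol_gaugeAct, GaugeGroup.dist1_conj]
  exact (hU p hp).le

end Estimate

end Summit.QuantumFields.YangMills.Theorems.UnitScaleGibbsActionDerivFlatPairing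

end
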